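import Summits.ResolutionOfSingularities.ResolutionOfSingularities.Theorems.UniversalCellsCampaignW82PrimeFieldReach
import Summits.ResolutionOfSingularities.ResolutionOfSingularities.Theorems.UniversalCellsCampaignW82PrimeFieldReachOutside
import Summits.ResolutionOfSingularities.ResolutionOfSingularities.Theorems.UniversalCellsCampaignW82OneFieldLinks
import Summits.ResolutionOfSingularities.ResolutionOfSingularities.Theorems.HironakaBridgeLinks
import Mathlib.Algebra.Algebra.ZMod
import HarnessLib

/-!
# [OURS · L1 W8.2] THE REACH OF THE PRIME FIELD — links by name: what door 1's antecedent gives outright,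
# the perfect-field dichotomy (reached iff algebraic), and the countable residual of the descent chain

Cell `res-hironaka` (run/shared/lean/pub/res-hironaka/), LADDER-RESOLUTION rung L (RESCUE), slot W8.2; host route
`UniversalCells`, host item `PrimeFieldToPerfect` (stmt-ResolutionOfSingularities-15233), door 1. Links leaf
(imports the Theses cone through `…OneFieldLinks` / `HironakaBridgeLinks`), written by res-L1-s82-pv-1 (gen 5),
over the Theses-free proofs files `…PrimeFieldReach.lean` (p533580) and `…PrimeFieldReachOutside.lean`.

Door 1's antecedent is `PrimeFieldRes p` (resolution of reduced separated schemes of finite type over `ZMod p`;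
`Theorems/HironakaBridge.lean`). By rung B1 (`Theorems.fgLevelRes_of_primeFieldRes`, half (a) of the crux) it
resolves every finitely generated level, so the reach theorem applies:

* `hasResolution_of_primeFieldRes_of_separablyExhausted` — **`PrimeFieldRes p` ⇒ resolution over every field of
  characteristic `p` separably exhausted by finitely generated subfields**; corollaries
  `…_of_separatingTranscendenceBasis_bot` (every field with a separating transcendence basis over `𝔽_p`, any
  transcendence degree: `𝔽_p(x_σ)`, `𝔽̄_p(x_σ)`, `𝔽_p(x_σ)^{sep}`, …), `…_of_isSeparable_fg` (separable algebraic
  over a finitely generated field), `…_of_isAlgebraic` (algebraic over `𝔽_p`).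
* `perfectField_reach_dichotomy` — **FOR PERFECT FIELDS THE MECHANISM REACHES EXACTLY THE ALGEBRAIC ONES**: a perfect
  `k` algebraic over `𝔽_p` is resolved outright from `PrimeFieldRes p`; a perfect `k` with a transcendental is
  separable over NONE of its finitely generated subfields containing it (`…PrimeFieldReachOutside`). So the crux
  `PrimeFieldToPerfect` is, beyond half (a) + separable ascent, EXACTLY its restriction to perfect fields of
  positive transcendence degree: `primeFieldToPerfect_iff_transcendental`.
* `primeFieldScope_iff_countable_residual` — **THE DESCENT CHAIN OF ROUTE `UniversalCells` HAS A COUNTABLE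
  RESIDUAL BY NAME**: `(PrimeFieldRes p → ResolutionInChar p)` (= `PrimeFieldToPerfect`'s slice followed by
  `DescentPerfectToAll`'s, cf. `primeFieldScope_iff_descentAt_and_climb`) is EQUIVALENT to `PrimeFieldRes p →`
  resolution over every COUNTABLE field of characteristic `p` that is NOT separably exhausted by finitely generated
  subfields (countable subfields decide, `hasResolution_of_countableLevels`; exhausted ones are reached). Inhabitants
  of that class by name: the one field `Ω₁(p)` of door 1 (`not_separablyExhausted_oneField`) and the
  `𝔽_p((t))`-hulls of crux stmt-0549 (route `Descent`, `exists_countable_field_not_exhaustedByEssFiniteType`).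

HONEST FRAMING. OURS theorems about OURS statements (role replaced: §17 ¶2 p.89 l.59–62 of [Hironaka2017], typed AS
PRINTED as `S17Methodology.U89_3`); NOT statements of the manuscript; nothing attributed to its author; no typed
candidate used (`PrimeFieldRes p` enters only as a hypothesis). Normal forms and reach statements, not progress
on the open residual. AI work, weaker than expert review; no claim beyond the kernel.
-/

noncomputable section

set_option linter.dupNamespace false -- mandated namespace of this single-conjunct summit

open CategoryTheory CategoryTheory.Limits AlgebraicGeometry TopologicalSpace
open Literature.AlgebraicGeometry.Resolution
open Summit.ResolutionOfSingularities.ResolutionOfSingularities.Theorems (PerfectRes PrimeFieldRes FgLevelRes)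

namespace Summit.ResolutionOfSingularities.ResolutionOfSingularities.Theorems.CampaignW82

/-! ## §1 What `PrimeFieldRes p` gives outright -/

/-- **`PrimeFieldRes p` ⇒ resolution over every field separably exhausted by finitely generated subfields.** Rung
B1 (`fgLevelRes_of_primeFieldRes`: half (a), spreading out + generic fibre) resolves the finitely generated levels;
`hasResolution_of_fgLevelRes_of_separablyExhausted` ascends. [cite: EGAIV2, Prop. 6.7.4] -/
theorem hasResolution_of_primeFieldRes_of_separablyExhausted (p : ℕ) [Fact p.Prime] (h0 : PrimeFieldRes p)
    (k : Type) [Field k] [CharP k p]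
    (hsep : ∀ s : Finset k, ∃ (L : Subfield k) (t : Finset k), L = Subfield.closure (↑t : Set k) ∧
      (↑s : Set k) ⊆ L ∧ ∀ u : Finset k, LinearIndepOn L _root_.id (↑u : Set k) →
        LinearIndepOn L (fun x : k => x ^ p) (↑u : Set k))
    (X : Scheme.{0}) (f : X ⟶ Spec (.of k)) [IsSeparated f] [LocallyOfFiniteType f] [QuasiCompact f]
    [IsReduced X] : Scheme.HasResolution X :=
  hasResolution_of_fgLevelRes_of_separablyExhausted p k (fgLevelRes_of_primeFieldRes p h0 k) hsep X f

/-- **`PrimeFieldRes p` ⇒ resolution over every field with a separating transcendence basis over the prime field**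
(any transcendence degree). [cite: Matsumura1987, §26 Thm. 26.5–26.8] -/
theorem hasResolution_of_primeFieldRes_of_separatingTranscendenceBasis_bot (p : ℕ) [Fact p.Prime]
    (h0 : PrimeFieldRes p) (k : Type) [Field k] [CharP k p] (B : Set k)
    (hB : ∀ (n : ℕ) (t : Fin n → k), Function.Injective t → Set.range t ⊆ B →
      ∀ e : (Fin n → Fin p) → k, ∑ α, (∏ i, t i ^ (α i : ℕ)) * e α ^ p = 0 → ∀ α, e α = 0)
    [Algebra.IsSeparable (IntermediateField.adjoin (⊥ : Subfield k) B) k]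
    (X : Scheme.{0}) (f : X ⟶ Spec (.of k)) [IsSeparated f] [LocallyOfFiniteType f] [QuasiCompact f]
    [IsReduced X] : Scheme.HasResolution X :=
  hasResolution_of_fgLevelRes_of_separatingTranscendenceBasis_bot p k (fgLevelRes_of_primeFieldRes p h0 k) B hB X f

/-- **`PrimeFieldRes p` ⇒ resolution over every field separable algebraic over a finitely generated subfield.**
[cite: EGAIV2, Prop. 6.7.4] -/
theorem hasResolution_of_primeFieldRes_of_isSeparable_fg (p : ℕ) [Fact p.Prime] (h0 : PrimeFieldRes p)
    (k : Type) [Field k] [CharP k p] (L₀ : Subfield k) (s₀ : Finset k)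
    (hL₀ : L₀ = Subfield.closure (↑s₀ : Set k)) [Algebra.IsSeparable L₀ k]
    (X : Scheme.{0}) (f : X ⟶ Spec (.of k)) [IsSeparated f] [LocallyOfFiniteType f] [QuasiCompact f]
    [IsReduced X] : Scheme.HasResolution X :=
  hasResolution_of_fgLevelRes_of_isSeparable_fg p k (fgLevelRes_of_primeFieldRes p h0 k) L₀ s₀ hL₀ X f

/-- **`PrimeFieldRes p` ⇒ resolution over every field ALGEBRAIC over `𝔽_p`** (e.g. every perfect field of
transcendence degree `0`: `𝔽̄_p`, `⋃ₙ 𝔽_{p^{2^n}}`, …): such a field is separable algebraic over the finitely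
generated (indeed prime) subfield `⊥ = closure ∅`, which is perfect (`x^p = x` on `⊥`). [folklore] -/
theorem hasResolution_of_primeFieldRes_of_isAlgebraic (p : ℕ) [Fact p.Prime] (h0 : PrimeFieldRes p)
    (k : Type) [Field k] [CharP k p] [Algebra (ZMod p) k] [Algebra.IsAlgebraic (ZMod p) k]
    (X : Scheme.{0}) (f : X ⟶ Spec (.of k)) [IsSeparated f] [LocallyOfFiniteType f] [QuasiCompact f]
    [IsReduced X] : Scheme.HasResolution X := by
  classical
  haveI : CharP (⊥ : Subfield k) p := (⊥ : Subfield k).subtype.charP Subtype.val_injective p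
  haveI : PerfectField (⊥ : Subfield k) :=
    perfectField_subfield_of_forall_exists_pow_eq p (⊥ : Subfield k) (forall_mem_bot_exists_pow_eq p k)
  letI : Algebra (ZMod p) (⊥ : Subfield k) := ZMod.algebra _ p
  haveI : Algebra.IsAlgebraic (⊥ : Subfield k) k :=
    Algebra.IsAlgebraic.ringHom_of_comp_eq (R := ZMod p) (A := k) (f := algebraMap (ZMod p) (⊥ : Subfield k))
      (g := RingHom.id k) (algebraMap (ZMod p) (⊥ : Subfield k)).injective Function.surjective_id
      (Subsingleton.elim _ _)
  haveI : Algebra.IsSeparable (⊥ : Subfield k) k := Algebra.IsAlgebraic.isSeparable_of_perfectField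
  exact hasResolution_of_primeFieldRes_of_isSeparable_fg p h0 k ⊥ ∅
    (by rw [Finset.coe_empty, Subfield.closure_empty]) X f

/-! ## §2 Perfect fields: reached iff algebraic -/

/-- **THE PERFECT-FIELD DICHOTOMY OF DOOR 1'S MECHANISM.** For a perfect field `k` of characteristic `p`:
(i) if `k` is algebraic over `𝔽_p`, `PrimeFieldRes p` resolves every reduced separated `k`-scheme of finite type
(`hasResolution_of_primeFieldRes_of_isAlgebraic`); (ii) if `k` contains a transcendental, `k` is separably exhausted
by NO system of finitely generated subfields (`not_separablyExhausted_of_perfectField_of_transcendental`), so the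
reach theorem `hasResolution_of_primeFieldRes_of_separablyExhausted` is silent about `k`. The crux
`PrimeFieldToPerfect` beyond its half (a) is therefore exactly its restriction to perfect fields of positive
transcendence degree (`primeFieldToPerfect_iff_transcendental`). [cite: Matsumura1987, §26 Thm. 26.4 and Thm. 26.8] -/
theorem perfectField_reach_dichotomy (p : ℕ) [Fact p.Prime] (k : Type) [Field k] [CharP k p] [PerfectField k]
    [Algebra (ZMod p) k] :
    (Algebra.IsAlgebraic (ZMod p) k → PrimeFieldRes p →
      ∀ (X : Scheme.{0}) (f : X ⟶ Spec (.of k)), IsSeparated f → LocallyOfFiniteType f → QuasiCompact f →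
        IsReduced X → Scheme.HasResolution X) ∧
    (Algebra.Transcendental (ZMod p) k →
      ¬ ∀ s : Finset k, ∃ (L : Subfield k) (t : Finset k), L = Subfield.closure (↑t : Set k) ∧
        (↑s : Set k) ⊆ L ∧ ∀ u : Finset k, LinearIndepOn L _root_.id (↑u : Set k) →
          LinearIndepOn L (fun x : k => x ^ p) (↑u : Set k)) := by
  refine ⟨fun halg h0 X f _ _ _ _ => ?_, fun htr => ?_⟩
  · haveI := halg
    exact hasResolution_of_primeFieldRes_of_isAlgebraic p h0 k X f
  · obtain ⟨x, hx⟩ := htr.transcendental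
    exact not_separablyExhausted_of_perfectField_of_transcendental p k hx

/-- Resolution of integral separated schemes of finite type over `ZMod p` (the antecedent of the crux's `p`-slice)
gives `PrimeFieldRes p` (the reduced form): resolve the integral irreducible components and glue
(`hasResolution_of_forall_closeds`). [folklore] -/
theorem primeFieldRes_of_integral {p : ℕ} [Fact p.Prime]
    (h₀ : ∀ (X : Scheme.{0}) (f : X ⟶ Spec (.of (ZMod p))), IsSeparated f → LocallyOfFiniteType f →
      QuasiCompact f → IsIntegral X → Scheme.HasResolution X) : PrimeFieldRes p := by
  intro X f _ _ _ _
  refine hasResolution_of_forall_closeds X f fun Z hZ => ?_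
  exact h₀ _ ((Scheme.IdealSheafData.vanishingIdeal Z).subschemeι ≫ f) inferInstance inferInstance
    inferInstance hZ

/-- **THE CRUX IS ITS RESTRICTION TO PERFECT FIELDS OF POSITIVE TRANSCENDENCE DEGREE.** `PrimeFieldToPerfect`
(stmt-ResolutionOfSingularities-15233, verbatim via `primeFieldToPerfect_iff`) holds iff for every prime `p`,
resolution of integral separated schemes of finite type over `ZMod p` implies resolution of reduced separated schemes
of finite type over every perfect field of characteristic `p` CONTAINING A TRANSCENDENTAL — the algebraic perfect
fields being settled by half (a) + separable ascent (`hasResolution_of_primeFieldRes_of_isAlgebraic`). All the fields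
that remain are outside the reach of that mechanism (`perfectField_reach_dichotomy` (ii)). [folklore] -/
theorem primeFieldToPerfect_iff_transcendental :
    Summit.ResolutionOfSingularities.ResolutionOfSingularities.Theses.UniversalCells.PrimeFieldToPerfect ↔
      ∀ (p : ℕ), p.Prime →
        (∀ (X : Scheme.{0}) (f : X ⟶ Spec (.of (ZMod p))), IsSeparated f → LocallyOfFiniteType f →
            QuasiCompact f → IsIntegral X → Scheme.HasResolution X) →
          ∀ (k : Type) [Field k] [CharP k p] [PerfectField k] [Algebra (ZMod p) k],
            Algebra.Transcendental (ZMod p) k →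
              ∀ (X : Scheme.{0}) (f : X ⟶ Spec (.of k)), IsSeparated f → LocallyOfFiniteType f →
                QuasiCompact f → IsReduced X → Scheme.HasResolution X := by
  rw [primeFieldToPerfect_iff]
  refine forall_congr' fun p => forall_congr' fun hp => ?_
  haveI : Fact p.Prime := ⟨hp⟩
  constructor
  · intro h h₀ k _ _ _ _ _ X f hs hl hq hr
    exact h h₀ k X f hs hl hq hr
  · intro h h₀ k _ _ _ X f hs hl hq hr
    letI : Algebra (ZMod p) k := ZMod.algebra k p
    haveI := hs; haveI := hl; haveI := hq; haveI := hr
    by_cases halg : Algebra.IsAlgebraic (ZMod p) k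
    · exact hasResolution_of_primeFieldRes_of_isAlgebraic p (primeFieldRes_of_integral h₀) k X f
    · rw [← Algebra.transcendental_iff_not_isAlgebraic] at halg
      exact h h₀ k halg X f hs hl hq hr

/-! ## §3 The descent chain of route `UniversalCells` has a countable residual -/

/-- **COUNTABLE RESIDUAL OF THE DESCENT CHAIN, BY NAME.** The composite of the two descent cruxes of route
`UniversalCells` at a prime `p` — «resolution over `𝔽_p` ⇒ resolution over every field of characteristic `p`»,
`PrimeFieldRes p → ResolutionInChar p` (`primeFieldScope_iff_descentAt_and_climb`: `= DescentAt p ∧` door 1's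
kernel) — is EQUIVALENT to: `PrimeFieldRes p` ⇒ resolution of every reduced separated scheme of finite type over
every COUNTABLE field of characteristic `p` that is NOT separably exhausted by finitely generated subfields.
(`→`: specialisation. `←`: countable subfields decide (`hasResolution_of_countableLevels`); an exhausted countable
subfield is reached (`hasResolution_of_primeFieldRes_of_separablyExhausted`), a non-exhausted one is the
hypothesis.) Kernel inhabitants of the residual class: door 1's one field `Ω₁(p)` (`not_separablyExhausted_oneField`)
and the `𝔽_p((t))`-hulls of stmt-0549 (route `Descent`). [cite: Matsumura1987, Thm. 26.4] -/
theorem primeFieldScope_iff_countable_residual (p : ℕ) [Fact p.Prime] :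
    (PrimeFieldRes p → ResolutionInChar.{0} p) ↔
      (PrimeFieldRes p → ∀ (k : Type) [Field k] [CharP k p], Countable k →
        (¬ ∀ s : Finset k, ∃ (L : Subfield k) (t : Finset k), L = Subfield.closure (↑t : Set k) ∧
          (↑s : Set k) ⊆ L ∧ ∀ u : Finset k, LinearIndepOn L _root_.id (↑u : Set k) →
            LinearIndepOn L (fun x : k => x ^ p) (↑u : Set k)) →
        ∀ (X : Scheme.{0}) (f : X ⟶ Spec (.of k)), IsSeparated f → LocallyOfFiniteType f →
          QuasiCompact f → IsReduced X → Scheme.HasResolution X) := by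
  constructor
  · intro h h0 k _ _ _ _ X f hs hl hq hr
    exact h h0 k X f hs hl hq hr
  · intro h h0 k _ _ X f hs hl hq hr
    haveI := hs; haveI := hl; haveI := hq; haveI := hr
    refine hasResolution_of_countableLevels p k (fun K hKc Z g hs' hl' hq' hr' => ?_) X f
    haveI : CharP K p := K.subtype.charP Subtype.val_injective p
    haveI : Countable K := hKc.to_subtype
    haveI := hs'; haveI := hl'; haveI := hq'; haveI := hr'
    by_cases hex : ∀ s : Finset K, ∃ (L : Subfield K) (t : Finset K), L = Subfield.closure (↑t : Set K) ∧
        (↑s : Set K) ⊆ L ∧ ∀ u : Finset K, LinearIndepOn L _root_.id (↑u : Set K) →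
          LinearIndepOn L (fun x : K => x ^ p) (↑u : Set K)
    · exact hasResolution_of_primeFieldRes_of_separablyExhausted p h0 K hex Z g
    · exact h h0 K inferInstance hex Z g hs' hl' hq' hr'

/-- **The summit conjunct at `p` under the prime-field scope, residual form.** Combining with
`primeFieldScope_iff_descentAt_and_climb`: `DescentAt p ∧ (PrimeFieldRes p → ClimbRatFuncPerf p)` — slot W8.1's
descent slice and slot W8.2's kernel together — hold iff `PrimeFieldRes p` resolves the countable fields of
characteristic `p` outside the reach. Pure logic over the two equivalences. [folklore] -/
theorem descentAt_and_climb_iff_countable_residual (p : ℕ) [Fact p.Prime] :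
    (Summit.ResolutionOfSingularities.ResolutionOfSingularities.Theorems.DescentAt p ∧
        (PrimeFieldRes p → ClimbRatFuncPerf p)) ↔
      (PrimeFieldRes p → ∀ (k : Type) [Field k] [CharP k p], Countable k →
        (¬ ∀ s : Finset k, ∃ (L : Subfield k) (t : Finset k), L = Subfield.closure (↑t : Set k) ∧
          (↑s : Set k) ⊆ L ∧ ∀ u : Finset k, LinearIndepOn L _root_.id (↑u : Set k) →
            LinearIndepOn L (fun x : k => x ^ p) (↑u : Set k)) →
        ∀ (X : Scheme.{0}) (f : X ⟶ Spec (.of k)), IsSeparated f → LocallyOfFiniteType f →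
          QuasiCompact f → IsReduced X → Scheme.HasResolution X) := by
  rw [← primeFieldScope_iff_descentAt_and_climb, primeFieldScope_iff_countable_residual]

/-- **The one field of door 1 lies in the residual class** (restated next to the countable residual): for every
prime `p` and every perfect `Ω` purely inseparable over `Frac 𝔽_p[x_ℕ]` — the field of
`primeFieldToPerfect_iff_oneField` — `Ω` is not separably exhausted by finitely generated subfields. [folklore] -/
theorem oneField_mem_residual (p : ℕ) [Fact p.Prime] (Ω : Type) [Field Ω] [PerfectField Ω]
    [Algebra (FractionRing (MvPolynomial ℕ (ZMod p))) Ω]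
    [IsPurelyInseparable (FractionRing (MvPolynomial ℕ (ZMod p))) Ω] :
    ¬ ∀ s : Finset Ω, ∃ (L : Subfield Ω) (t : Finset Ω), L = Subfield.closure (↑t : Set Ω) ∧
      (↑s : Set Ω) ⊆ L ∧ ∀ u : Finset Ω, LinearIndepOn L _root_.id (↑u : Set Ω) →
        LinearIndepOn L (fun x : Ω => x ^ p) (↑u : Set Ω) := by
  haveI : CharP (FractionRing (MvPolynomial ℕ (ZMod p))) p :=
    charP_of_injective_algebraMap (IsFractionRing.injective (MvPolynomial ℕ (ZMod p)) _) p
  haveI : CharP Ω p :=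
    charP_of_injective_algebraMap (algebraMap (FractionRing (MvPolynomial ℕ (ZMod p))) Ω).injective p
  exact not_separablyExhausted_oneField p Ω

end Summit.ResolutionOfSingularities.ResolutionOfSingularities.Theorems.CampaignW82

end
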